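import Literature.NumberTheory.EllipticCurves.KernelReductionDivisibleThreeProofs
import Literature.NumberTheory.EllipticCurves.TorsionFilAtCyclicMultiplicativeThreeProofs
import Literature.NumberTheory.EllipticCurves.ZpExtensionEisensteinOrdinaryFilTransferProofs
import Literature.NumberTheory.EllipticCurves.SelmerInertia
import HarnessLib

/-!
# `E₁(K̄_v)` is `3`-divisible and `×3 : Fil_v E[3^{k+1}] → Fil_v E[3^k]` is onto at a place `v ∣ 3` of MULTIPLICATIVE reduction
# (number-field currency of `KernelReductionDivisibleThreeProofs`; theorems only, no definition, no named fact, no instance, no `sorry`)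

Topic `NumberTheory/EllipticCurves` (LEAD `bsd-wall-utd-p1`, crux r205 stmt-BirchSwinnertonDyer-24737, line `beta-road`, stub
`stub_howardOutputsOfFamily`, E2 unit at `v ∣ 3`).  Cell x9's `exists_nsmul_eq_of_mem_localKernelOfReduction` and
`exists_mem_torsionFilAt_reduce_eq` (the `hFsurj` input of `ZpExtension.eisensteinTwistTransfer_mem_twistedFil`, hence of the ANN-SAT /
(Exact) / H.5(b) assemblies at `v ∣ p`) assume GOOD reduction with an ordinary point.  Here the same two statements at a place `v ∋ 3`
of MULTIPLICATIVE reduction of `E/K`, from `exists_zsmul_three_eq_of_one_lt_val` (height one: `b₂(Ẽ_v) ≠ 0`,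
`reductionAt_b₂_ne_zero_of_hasMultiplicativeReductionAt_three`):

* **`exists_nsmul_eq_of_mem_localKernelOfReduction_of_hasMultiplicativeReductionAt_three`** — `E₁(K̄_v)` is `3`-divisible;
* **`exists_mem_torsionFilAt_reduce_eq_of_hasMultiplicativeReductionAt_three`** — `×3 : Fil_v E[3^{k+1}] → Fil_v E[3^k]` is onto.
This supersedes the conditional `…_of_componentClause_three` forms of `LocalKernelOfReductionDivisibleOfComponentProofs` (the component
clause is no longer needed).  With `TorsionFilAtCyclic{OfOrdinaryPoint,MultiplicativeThree}Proofs`,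
`ZpExtensionEisensteinOrdinaryCoreIsotropyOfOrdinaryPointProofs` and this file, every `v ∣ 3` local input of the twin's E2 unit that x9
states under `(hgood, p ∤ a_v)` is available at the twin's multiplicative places.

References: J. H. Silverman, AEC (2009), Prop. VII.2.2, IV.3.2(b), Ex. 3.7(d), Cor. III.6.4 [SilvermanAEC2009]; R. Greenberg, LNM 1716
(1999), §2 p. 82 [GreenbergLNM1716].  BSD is not proved by any of this.
-/

noncomputable section

open scoped NNReal Classical ContRepresentation
open NumberField IsDedekindDomain Field

namespace WeierstrassCurve

open Literature.NumberTheory.EllipticCurves Literature.NumberTheory.GaloisRepresentations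
  IsDedekindDomain.HeightOneSpectrum AddSubgroup

universe u

variable {K : Type u} [Field K] [NumberField K] (W : WeierstrassCurve K) [W.IsElliptic]
  (v : HeightOneSpectrum (𝓞 K))

/-- **`E₁(K̄_v)` is `3`-divisible at a place `v ∋ 3` of multiplicative reduction**: for `a ∈ E₁(K̄_v)` there is `b ∈ E₁(K̄_v)` with
`3 • b = a` (`KernelReductionDivisibleThreeProofs.exists_zsmul_three_eq_of_one_lt_val` on the minimal model at `v`, whose `b₂` is a
`v`-unit; for the Tate curve: `1 + 𝔪 ⊂ K̄_vˣ/q^ℤ` is `3`-divisible). The binder shape of x9's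
`exists_nsmul_eq_of_mem_localKernelOfReduction`. [cite: GreenbergLNM1716, §2 p. 82 («since 𝓕(𝔪̄) is divisible»)]
[cite: SilvermanAEC2009, Prop. VII.2.2 and IV.3.2(b)] -/
theorem exists_nsmul_eq_of_mem_localKernelOfReduction_of_hasMultiplicativeReductionAt_three
    (h3v : ((3 : ℕ) : 𝓞 K) ∈ v.asIdeal) (hmult : W.HasMultiplicativeReductionAt v)
    {a : localPoints W (v.adicCompletion K)} (ha : a ∈ W.localKernelOfReduction v) :
    ∃ b : localPoints W (v.adicCompletion K), b ∈ W.localKernelOfReduction v ∧ (3 : ℕ) • b = a := by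
  have hw := coe_spectralValuation v
  -- the generic fibre of the minimal model over `K̄_v`, integral for the spectral valuation, elliptic
  have hint : (((W.localMinimalIntegralModel v).map
      (algebraMap (v.adicCompletionIntegers K) (v.adicCompletion K))).baseChange
        (AlgebraicClosure (v.adicCompletion K))).IsIntegral (v.spectralValuation).integer :=
    isIntegral_spectralValuation_baseChange hw (W.localMinimalIntegralModel v)
  haveI := hint
  have hX : (W.localMinimalIntegralModel v).map
      (algebraMap (v.adicCompletionIntegers K) (v.adicCompletion K)) = W.localMinimalModel v :=
    baseChange_integralModel_eq (v.adicCompletionIntegers K) (W.localMinimalModel v)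
  haveI : (((W.localMinimalIntegralModel v).map
      (algebraMap (v.adicCompletionIntegers K) (v.adicCompletion K))).baseChange
        (AlgebraicClosure (v.adicCompletion K))).IsElliptic := by
    haveI := W.isElliptic_localMinimalModel v
    rw [hX]; infer_instance
  -- `|3|_v < 1`
  have h3mem : (3 : v.adicCompletionIntegers K) ∈ IsLocalRing.maximalIdeal (v.adicCompletionIntegers K) := by
    have h := (algebraMap_mem_maximalIdeal_adicCompletionIntegers_iff (v := v) ((3 : ℕ) : 𝓞 K)).mpr h3v
    simpa only [map_natCast, Nat.cast_ofNat, map_ofNat] using h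
  have h3 : v.spectralValuation (3 : AlgebraicClosure (v.adicCompletion K)) < 1 := by
    have hcoe : ((3 : v.adicCompletionIntegers K) : v.adicCompletion K) = 3 := by norm_cast
    have e : (3 : AlgebraicClosure (v.adicCompletion K)) =
        algebraMap (v.adicCompletion K) _ ((3 : v.adicCompletionIntegers K) : v.adicCompletion K) := by
      rw [hcoe, map_ofNat]
    rw [e, ← NNReal.coe_lt_coe, coe_spectralValuation_algebraMap hw, NNReal.coe_one,
      Valued.toNormedField.norm_lt_one_iff]
    exact mem_maximalIdeal_adicCompletionIntegers_iff.mp h3mem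
  -- `|b₂|_v = 1`
  have hb₂unit : IsUnit (W.localMinimalIntegralModel v).b₂ := by
    by_contra hnu
    have hmem : (W.localMinimalIntegralModel v).b₂ ∈ IsLocalRing.maximalIdeal (v.adicCompletionIntegers K) :=
      (IsLocalRing.mem_maximalIdeal _).mpr hnu
    apply W.reductionAt_b₂_ne_zero_of_hasMultiplicativeReductionAt_three v h3v hmult
    rw [reductionAt_eq_map_residue, map_b₂]
    exact (IsLocalRing.residue_eq_zero_iff _).mpr hmem
  have hb₂ : v.spectralValuation (((W.localMinimalIntegralModel v).map
      (algebraMap (v.adicCompletionIntegers K) (v.adicCompletion K))).baseChange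
        (AlgebraicClosure (v.adicCompletion K))).b₂ = 1 := by
    rw [baseChange, map_b₂, map_b₂]
    exact spectralValuation_eq_one_of_isUnit hw hb₂unit
  -- the point
  set T := W.localPointsEquivModel v with hT
  rcases hTa : T a with _ | ⟨x, y, hxy⟩
  · refine ⟨0, AddSubgroup.zero_mem _, ?_⟩
    apply T.injective
    rw [smul_zero, map_zero, hTa]
    rfl
  · have hx : 1 < v.spectralValuation x := (W.mem_localKernelOfReduction_iff_of_eq_some v hTa).mp ha
    obtain ⟨x', y', hxy', hx', h3Q⟩ := exists_zsmul_three_eq_of_one_lt_val (w := v.spectralValuation) h3 hb₂ hxy hx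
    refine ⟨T.symm (.some x' y' hxy'), ?_, ?_⟩
    · exact (W.mem_localKernelOfReduction_iff_of_eq_some v (T.apply_symm_apply _)).mpr hx'
    · apply T.injective
      rw [map_nsmul, AddEquiv.apply_symm_apply, hTa, ← natCast_zsmul]
      exact h3Q

/-- **`×3 : Fil_v E[3^{k+1}] → Fil_v E[3^k]` is onto at a place `v ∋ 3` of multiplicative reduction** — the binder `hFsurj` of x9's
`ZpExtension.eisensteinTwistTransfer_mem_twistedFil` / the conclusion of `exists_mem_torsionFilAt_reduce_eq` (there: good reduction +
ordinary point): `E₁(K̄_v)` is `3`-divisible and torsion of `E(K̄_v)` is algebraic. [cite: GreenbergLNM1716, §2 p. 82]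
[cite: SilvermanAEC2009, Cor. III.6.4 and VII.2] -/
theorem exists_mem_torsionFilAt_reduce_eq_of_hasMultiplicativeReductionAt_three
    (h3v : ((3 : ℕ) : 𝓞 K) ∈ v.asIdeal) (hmult : W.HasMultiplicativeReductionAt v)
    (t : ∀ k, (W.torsionGaloisModule (((3 : ℕ) : ℤ) ^ (k + 1))).toContRepresentation →ⁱL
      (W.torsionGaloisModule (((3 : ℕ) : ℤ) ^ k)).toContRepresentation)
    (ht : ∀ k (P : geomTorsion W (((3 : ℕ) : ℤ) ^ (k + 1))), t k P = W.geomTorsionReduce 3 k P)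
    (k : ℕ) (y : geomTorsion W (((3 : ℕ) : ℤ) ^ k)) (hy : y ∈ W.torsionFilAt v (((3 : ℕ) : ℤ) ^ k)) :
    ∃ y' ∈ W.torsionFilAt v (((3 : ℕ) : ℤ) ^ (k + 1)), t k y' = y := by
  obtain ⟨b, hb, hpb⟩ := W.exists_nsmul_eq_of_mem_localKernelOfReduction_of_hasMultiplicativeReductionAt_three v h3v hmult
    ((W.mem_torsionFilAt_iff v _ y).mp hy)
  -- `b` is `3^{k+1}`-torsion, hence algebraic
  have hy0 : (((3 : ℕ) : ℤ) ^ k) • (y : geomPoints W) = 0 := (mem_geomTorsion_iff W _ _).mp y.2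
  have hbtor : (3 ^ (k + 1)) • b = 0 := by
    rw [pow_succ, mul_nsmul', hpb, ← map_nsmul, ← natCast_zsmul, Nat.cast_pow, hy0, map_zero]
  obtain ⟨P, hP, hPb⟩ := exists_pointsMapOfEmb_eq_of_nsmul_eq_zero W (closureEmb (K := K) (v.adicCompletion K))
    (pow_ne_zero (k + 1) three_ne_zero) hbtor
  have hPmem : P ∈ geomTorsion W (((3 : ℕ) : ℤ) ^ (k + 1)) := by
    rw [mem_geomTorsion_iff, ← Nat.cast_pow, natCast_zsmul]; exact hP
  refine ⟨⟨P, hPmem⟩, (W.mem_torsionFilAt_iff v _ _).mpr (by rw [hPb]; exact hb), ?_⟩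
  rw [ht]
  apply Subtype.ext
  rw [W.coe_geomTorsionReduce]
  apply pointsMapOfEmb_injective W (closureEmb (K := K) (v.adicCompletion K))
  change pointsMapOfEmb W (closureEmb (K := K) (v.adicCompletion K)) (((3 : ℕ) : ℤ) • P) =
    pointsMapOfEmb W (closureEmb (K := K) (v.adicCompletion K)) (y : geomPoints W)
  rw [map_zsmul, hPb, ← hpb, natCast_zsmul]

end WeierstrassCurve

end
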